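import Mathlib
import HarnessLib
import Summits.HubbardSuperconductivity.HubbardSuperconductivity.Theorems.LiebTwinNoOnsiteODLROLittleOSusceptibility

/-!
# Crux `NoOnsiteODLRO` (stmt-HubbardSuperconductivity-0933), line `registered`, skeleton rev 2 — the GLUE
# `StrictPairWindow → (window ⇒ little-o shifted susceptibility) → NoOnsiteODLRO`

Lead c2's reshaped reduction of the crux (Cruxes/NoOnsiteODLRO/Lines/birth.lean rev 2), as a kernel-checked
tree theorem. Acting on the disprover's exposure result (`Negative/ShiftedInfraredBoundKernel.lean`, p153023:
any `K₋`-form infrared bound quantified over ALL vectors of the pair-removed sector silently asserts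
`P_s ψ_L ⊥ ker K₋` on the closed-window branch), the strict pair window is carried as an explicit, separate
hypothesis `hW` (census B4), and the open core `hχ` is the little-`o` `U`-shifted susceptibility bound CONDITIONAL
on that window — which is crux-EQUIVALENT (it follows from the crux along the same sequence by Cauchy–Schwarz and
`Re⟨v, K₋ v⟩ ≥ κ‖v‖²`, the argument of `littleO_susceptibility_of_noOnsiteODLRO`, p148448). The composition is per
sequence: the window constants `(κ, L₁)` feed the core, whose bound at tolerance `ε' = min(1,ε)³/(K₀+1)`
(`K₀ = 4c₀²`, `c₀` the crude a-priori constant of the extended-`s` pair field) feeds the landed per-side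
zero-temperature Falk–Bruch engine `falkBruch_fixedSide` (`S_L³ ≤ K₀ ε'² L¹² ≤ (εL⁴)³`). Pure real analysis
around two tree theorems; registered helper stub `stub_windowLittleOGlue`. Sources: Kubo–Kishi, PRB 41 (1990)
4866, Thm 2 / Remark 3 (the bound being transplanted); Falk–Bruch, Phys. Rev. 180 (1969) 442;
Dyson–Lieb–Simon, J. Stat. Phys. 18 (1978) 335, Thm 3.1; Yang, PRL 63 (1989) 2144 (the window). Folklore
bookkeeping; no definitions.
-/

noncomputable section

namespace Summit.HubbardSuperconductivity.NoOnsiteODLRO.Birth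

open Matrix Finset Filter
open scoped ComplexOrder
open Literature.Probability.LatticeModels Literature.MathematicalPhysics.QuantumLattice

/-- **Registered helper stub `stub_windowLittleOGlue` (line `registered`, skeleton rev 2):** a strict pair
window along every admissible sequence (`hW`) and, given such a window, the little-`o` `U`-shifted pair-removal
susceptibility bound (`hχ`) together imply the BODY of the crux `NoOnsiteODLRO` verbatim (per-sequence
Falk–Bruch through `falkBruch_fixedSide`). Kubo–Kishi, PRB 41 (1990) 4866, Remark 3; Dyson–Lieb–Simon,
J. Stat. Phys. 18 (1978) 335, Thm 3.1. [folklore] -/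
theorem stub_windowLittleOGlue :
    (∀ (U δ : ℝ), 0 < U → δ ∈ Set.Ioo (0 : ℝ) (1 / 2) →
      ∀ (N : ℕ → ℕ) (ψ : ∀ L, Fock (Orb (FermionTorus 2 L))),
        (∀ L, Even L → N L = 2 * ⌊(1 - δ) * (L : ℝ) ^ 2 / 2⌋₊ ∧ star (ψ L) ⬝ᵥ ψ L = 1 ∧
            IsGroundStateInSector (hubbardTorus 2 L 1 U) (N L) 0 (ψ L)) →
          ∃ κ : ℝ, 0 < κ ∧ ∃ L₁ : ℕ, ∀ (L : ℕ) [NeZero L], Even L → L₁ ≤ L →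
            κ ≤ U - ((hubbardTorus 2 L 1 U).minEnergyOn (szSector (Λ := FermionTorus 2 L) (N L) 0) -
              (hubbardTorus 2 L 1 U).minEnergyOn (szSector (Λ := FermionTorus 2 L) (N L - 2) 0))) →
    (∀ (U δ : ℝ), 0 < U → δ ∈ Set.Ioo (0 : ℝ) (1 / 2) →
      ∀ (N : ℕ → ℕ) (ψ : ∀ L, Fock (Orb (FermionTorus 2 L))),
        (∀ L, Even L → N L = 2 * ⌊(1 - δ) * (L : ℝ) ^ 2 / 2⌋₊ ∧ star (ψ L) ⬝ᵥ ψ L = 1 ∧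
            IsGroundStateInSector (hubbardTorus 2 L 1 U) (N L) 0 (ψ L)) →
          ∀ κ : ℝ, 0 < κ → ∀ L₁ : ℕ,
            (∀ (L : ℕ) [NeZero L], Even L → L₁ ≤ L →
              κ ≤ U - ((hubbardTorus 2 L 1 U).minEnergyOn (szSector (Λ := FermionTorus 2 L) (N L) 0) -
                (hubbardTorus 2 L 1 U).minEnergyOn (szSector (Λ := FermionTorus 2 L) (N L - 2) 0))) →
            ∀ ε : ℝ, 0 < ε → ∃ L₀ : ℕ, ∀ (L : ℕ) [NeZero L], Even L → L₀ ≤ L →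
              ∀ v : Fock (Orb (FermionTorus 2 L)), v ∈ szSector (Λ := FermionTorus 2 L) (N L - 2) 0 →
                ‖star v ⬝ᵥ ((pairField sWave L) *ᵥ (ψ L))‖ ^ 2 ≤
                  ε * (L : ℝ) ^ 4 *
                    ((expect (hubbardTorus 2 L 1 U) v).re +
                      (U - (hubbardTorus 2 L 1 U).minEnergyOn (szSector (Λ := FermionTorus 2 L) (N L) 0)) *
                        (star v ⬝ᵥ v).re)) →
    ∀ (U δ : ℝ), 0 < U → δ ∈ Set.Ioo (0 : ℝ) (1 / 2) →
      ∀ (N : ℕ → ℕ) (ψ : ∀ L, Fock (Orb (FermionTorus 2 L))),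
        (∀ L, Even L → N L = 2 * ⌊(1 - δ) * (L : ℝ) ^ 2 / 2⌋₊ ∧ star (ψ L) ⬝ᵥ ψ L = 1 ∧
            IsGroundStateInSector (hubbardTorus 2 L 1 U) (N L) 0 (ψ L)) →
          ∀ ε : ℝ, 0 < ε → ∃ L₀ : ℕ, ∀ (L : ℕ) [NeZero L], Even L → L₀ ≤ L →
            (expect (Matrix.conjTranspose (pairField sWave L) * pairField sWave L) (ψ L)).re / (L : ℝ) ^ 4 ≤ ε := by
  intro hW hχ U δ hU hδ N ψ hyp ε hε
  -- Stub 1 along this sequence, fed into Stub 2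
  obtain ⟨κ, hκ, L₁, hW'⟩ := hW U δ hU hδ N ψ hyp
  have hχ' := hχ U δ hU hδ N ψ hyp κ hκ L₁ (fun L _ hE hL => hW' L hE hL)
  -- the engine constant `K₀ = 4 c₀²`
  set K₀ : ℝ := 4 * (∑ e ∈ insert (0 : Site 2) unitSteps, ‖((extendedSWave e / Real.sqrt 2 : ℝ) : ℂ)‖ * 2) ^ 2
    with hK₀def
  have hK₀ : 0 ≤ K₀ := by positivity
  -- the auxiliary tolerance `ε' = min 1 ε ^ 3 / (K₀ + 1)` : `ε' ≤ 1` and `K₀ ε'² ≤ (min 1 ε)³ ≤ ε³`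
  set μ : ℝ := min 1 ε with hμdef
  have hμpos : 0 < μ := lt_min one_pos hε
  have hμ1 : μ ≤ 1 := min_le_left _ _
  have hμε : μ ≤ ε := min_le_right _ _
  have hK1 : 0 < K₀ + 1 := by linarith
  set ε' : ℝ := μ ^ 3 / (K₀ + 1) with hε'def
  have hε'pos : 0 < ε' := div_pos (pow_pos hμpos 3) hK1
  have hμ3 : μ ^ 3 ≤ 1 := pow_le_one₀ hμpos.le hμ1
  have hε'1 : ε' ≤ 1 := by
    rw [hε'def, div_le_one hK1]
    linarith
  have hKε : K₀ * ε' ^ 2 ≤ μ ^ 3 := by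
    have h1 : ε' ^ 2 ≤ ε' := by nlinarith
    calc K₀ * ε' ^ 2 ≤ (K₀ + 1) * ε' := by nlinarith
      _ = μ ^ 3 := by rw [hε'def]; field_simp
  obtain ⟨L₀, hL₀⟩ := hχ' ε' hε'pos
  refine ⟨L₀ + 3, fun L _ hEv hL => ?_⟩
  obtain ⟨hN, hψ1, hGS⟩ := hyp L hEv
  have hL3 : 3 ≤ L := by omega
  -- `2 ≤ N L`
  have hN2 : 2 ≤ N L := by
    rw [hN]
    have hδ1 : 1 / 2 < 1 - δ := by linarith [hδ.2]
    have hL3' : (3 : ℝ) ≤ L := by exact_mod_cast hL3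
    have hL9 : (9 : ℝ) ≤ (L : ℝ) ^ 2 := by nlinarith [hL3']
    have h1 : ((1 : ℕ) : ℝ) ≤ (1 - δ) * (L : ℝ) ^ 2 / 2 := by
      rw [Nat.cast_one, le_div_iff₀ (by norm_num : (0 : ℝ) < 2)]
      nlinarith
    have h1' : 1 ≤ ⌊(1 - δ) * (L : ℝ) ^ 2 / 2⌋₊ := Nat.le_floor h1
    omega
  -- the engine at prefactor `A = ε' L⁴`
  have hA : 0 ≤ ε' * (L : ℝ) ^ 4 := by positivity
  have hS3 : (expect ((pairField sWave L)ᴴ * pairField sWave L) (ψ L)).re ^ 3 ≤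
      K₀ * (ε' * (L : ℝ) ^ 4) ^ 2 * (L : ℝ) ^ 4 :=
    Summit.HubbardSuperconductivity.NoOnsiteODLRO.Birth.falkBruch_fixedSide hL3 U hN2 hψ1 hGS hA
      (hL₀ L hEv (by omega))
  have hLpos : (0 : ℝ) < (L : ℝ) := by exact_mod_cast (show 0 < L by omega)
  have hL4 : (0 : ℝ) < (L : ℝ) ^ 4 := by positivity
  rw [div_le_iff₀ hL4]
  refine le_of_pow_le_pow_left₀ (n := 3) (by norm_num) (by positivity) ?_
  calc (expect ((pairField sWave L)ᴴ * pairField sWave L) (ψ L)).re ^ 3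
      ≤ K₀ * (ε' * (L : ℝ) ^ 4) ^ 2 * (L : ℝ) ^ 4 := hS3
    _ = (K₀ * ε' ^ 2) * (L : ℝ) ^ 12 := by ring
    _ ≤ μ ^ 3 * (L : ℝ) ^ 12 := mul_le_mul_of_nonneg_right hKε (by positivity)
    _ ≤ ε ^ 3 * (L : ℝ) ^ 12 :=
        mul_le_mul_of_nonneg_right (pow_le_pow_left₀ hμpos.le hμε 3) (by positivity)
    _ = (ε * (L : ℝ) ^ 4) ^ 3 := by ring

/-- The crux `NoOnsiteODLRO` BY NAME from the two open stubs of skeleton rev 2 (hypothesis form).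
[folklore] -/
theorem noOnsiteODLRO_of_window_of_littleO
    (hW : ∀ (U δ : ℝ), 0 < U → δ ∈ Set.Ioo (0 : ℝ) (1 / 2) →
      ∀ (N : ℕ → ℕ) (ψ : ∀ L, Fock (Orb (FermionTorus 2 L))),
        (∀ L, Even L → N L = 2 * ⌊(1 - δ) * (L : ℝ) ^ 2 / 2⌋₊ ∧ star (ψ L) ⬝ᵥ ψ L = 1 ∧
            IsGroundStateInSector (hubbardTorus 2 L 1 U) (N L) 0 (ψ L)) →
          ∃ κ : ℝ, 0 < κ ∧ ∃ L₁ : ℕ, ∀ (L : ℕ) [NeZero L], Even L → L₁ ≤ L →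
            κ ≤ U - ((hubbardTorus 2 L 1 U).minEnergyOn (szSector (Λ := FermionTorus 2 L) (N L) 0) -
              (hubbardTorus 2 L 1 U).minEnergyOn (szSector (Λ := FermionTorus 2 L) (N L - 2) 0)))
    (hχ : ∀ (U δ : ℝ), 0 < U → δ ∈ Set.Ioo (0 : ℝ) (1 / 2) →
      ∀ (N : ℕ → ℕ) (ψ : ∀ L, Fock (Orb (FermionTorus 2 L))),
        (∀ L, Even L → N L = 2 * ⌊(1 - δ) * (L : ℝ) ^ 2 / 2⌋₊ ∧ star (ψ L) ⬝ᵥ ψ L = 1 ∧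
            IsGroundStateInSector (hubbardTorus 2 L 1 U) (N L) 0 (ψ L)) →
          ∀ κ : ℝ, 0 < κ → ∀ L₁ : ℕ,
            (∀ (L : ℕ) [NeZero L], Even L → L₁ ≤ L →
              κ ≤ U - ((hubbardTorus 2 L 1 U).minEnergyOn (szSector (Λ := FermionTorus 2 L) (N L) 0) -
                (hubbardTorus 2 L 1 U).minEnergyOn (szSector (Λ := FermionTorus 2 L) (N L - 2) 0))) →
            ∀ ε : ℝ, 0 < ε → ∃ L₀ : ℕ, ∀ (L : ℕ) [NeZero L], Even L → L₀ ≤ L →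
              ∀ v : Fock (Orb (FermionTorus 2 L)), v ∈ szSector (Λ := FermionTorus 2 L) (N L - 2) 0 →
                ‖star v ⬝ᵥ ((pairField sWave L) *ᵥ (ψ L))‖ ^ 2 ≤
                  ε * (L : ℝ) ^ 4 *
                    ((expect (hubbardTorus 2 L 1 U) v).re +
                      (U - (hubbardTorus 2 L 1 U).minEnergyOn (szSector (Λ := FermionTorus 2 L) (N L) 0)) *
                        (star v ⬝ᵥ v).re)) :
    Summit.HubbardSuperconductivity.HubbardSuperconductivity.Theses.LiebTwin.NoOnsiteODLRO :=
  stub_windowLittleOGlue hW hχ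

end Summit.HubbardSuperconductivity.NoOnsiteODLRO.Birth

end
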